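/-
Copyright (c) 2026. All rights reserved.
Released under Apache 2.0 license as described in the file LICENSE.
Authors: abc-iut cell, prover seat abc-iut-L4-t12 (gen 7).
-/
import Literature.AnabelianGeometry.AbsoluteAnabelian.ArchimedeanHolFieldFunctorGeometricOverIdRigid
import Literature.Topology.CoveringSpaces.CoveringConnectedIdRigid
import Literature.Topology.CoveringSpaces.CoveringIdRigidPuncturedTorus
import Literature.Geometry.Kaehler.ComplexTorus
import HarnessLib

/-!
# [AbsTopIII] Prop 4.2 (i), geometric column: the slice of `HolRS` over a once-punctured elliptic
# curve is id-rigid, unconditionally (type `(1,1)`)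

PROOF-ONLY instance file (abc-iut cell, campaign-L item R1.2 of the `EA` column of [AbsTopIII]
Prop 4.2 / Cor 4.5, at the objects that matter for [AbsTopIII] Cor 2.7 — once-punctured elliptic
curves).  S. Mochizuki, *Topics in Absolute Anabelian Geometry III*, proof of Prop 4.2 (i), kurims p.106
l.11–19 («the full subcategory of `EA` consisting of objects that map to `X` … [is id-rigid by] the
slimness assertion of Lemma 4.3»), and Def 4.1 (i) p.101 (elliptically admissible hyperbolic
orbicurves — the once-punctured elliptic curve is the basic hyperbolic curve of type `(1,1)`):

* `HolRS.ofOpens` — a connected open subset of any Riemann surface (`T2`, charted over `ℂ`, analytic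
  atlas) as an object of `HolRS` (generalises abc-iut-L4-t14's `HolRS.ofOpen` for open subsets of `ℂ`);
* `HolRS.puncturedTorus Φ x₀` — **the once-punctured elliptic curve `E ∖ {x₀}`**, `E = ℂ/Φ(ℤ²)` the
  complex torus of the tree (`Literature.Geometry.Kaehler.ComplexTorus Φ`, `Φ : (Fin 2 → ℝ) ≃L[ℝ] ℂ`),
  as an object of `HolRS`;
* **`HolRS.isIdRigid_over_puncturedTorus`** — the slice of `HolRS` over `E ∖ {x₀}` is id-rigid,
  UNCONDITIONALLY: `π₁(E ∖ {x₀}) ≅ F₂` (abc-iut-w5-d016,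
  `PuncturedTorus.nonempty_mulEquiv_freeGroup_puncturedTorus`), free profinite groups of rank `≥ 2`
  are slim (abc-iut-w5-d144), connected finite covers of a space with centre-free `π̂₁` form an
  id-rigid category (abc-iut-L6-t18, (3ε)), and `Over 𝕏 ≌ {connected finite covers of 𝕏^top}`
  (`HolRS.overEquivConnectedCovFin`);
* `HolRS.isIdRigid_mapsTo_puncturedTorus_of` — the formal specialisation of the (H1)+(H2) reduction
  `isIdRigid_mapsTo_of_connectedCover` at `E ∖ {x₀}` (recorded for uniformity of shape only — see the
  NOTE below: its hypothesis (H1) is NOT satisfiable here).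

HONEST SCOPE: slice / model level.  NOTE ON (H1) AT THE PUNCTURED TORUS (wording point of
abc-iut-L4-t14, adopted): (H1) «an automorphism of `E ∖ {x₀}` commuting with all its holomorphic
finite étale endomorphisms is the identity» FAILS for every once-punctured elliptic curve — the
involution `x ↦ 2x₀ - x` is a non-trivial automorphism, and for a hyperbolic Riemann surface of finite
type every finite étale endomorphism is an automorphism while `Aut(E, x₀)` (cyclic of order 2, 4 or 6)
is abelian, so the involution commutes with all endomorphisms.  Hence `isIdRigid_mapsTo_puncturedTorus_of`
is VACUOUS at this object: the EA-level statement «objects mapping to `E ∖ {x₀}`» requires print's own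
route (Lemma 4.3 for the orbicurve `[X / Aut X]`; abc-iut-L4-t14's `LocCategoryGroupModel` chain), for
which (H1) ∧ `Z(π̂₁) = 1` is only a SUFFICIENT special case.  The unconditional content of this file is
the SLICE statement `isIdRigid_over_puncturedTorus`.  Orbicurves untouched; nothing here bears on
[IUTchIII] Cor. 3.12.  Two packaging `def`s (`HolRS.ofOpens`, `HolRS.puncturedTorus`); no instances,
no Prop facts.

## References

* S. Mochizuki, *Topics in Absolute Anabelian Geometry III*, kurims ms, Def 4.1 (i) p.101; proof of
  Prop 4.2 (i) p.106 l.11–19. [MochizukiAbsTopIII2015]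
-/

noncomputable section

open CategoryTheory Set Topology TopologicalSpace
open scoped Manifold ContDiff
open Literature.AlgebraicGeometry.Frobenioids (IsSlimGroup)
open Literature.IUT.HodgeTheaters (profiniteCompletion)
open Literature.Topology.CoveringSpaces Literature.AlgebraicTopology.Homotopy
open Literature.AlgebraicTopology.FundamentalGroup Literature.Geometry.Kaehler

namespace Literature.AnabelianGeometry.AbsoluteAnabelian

namespace HolRS

/-! ### §1 Connected open subsets of a Riemann surface as objects of `HolRS` -/

/-- **A connected open subset of a Riemann surface is a connected Riemann surface** (object of
`HolRS`): Mathlib's charted-space / analytic-manifold structure on an open subtype.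
[cite: MochizukiAbsTopIII2015, Definition 4.1 (i) p.101] -/
def ofOpens {M : Type} [TopologicalSpace M] [T2Space M] [ChartedSpace ℂ M] [IsManifold 𝓘(ℂ, ℂ) ω M]
    (U : Opens M) (hU : IsConnected (U : Set M)) : HolRS :=
  haveI : ConnectedSpace U := isConnected_iff_connectedSpace.1 hU
  ⟨U⟩

/-- The underlying space of `ofOpens U hU` is the subtype `U`. [cite: MochizukiAbsTopIII2015, Definition 4.1 (i) p.101] -/
@[simp] theorem ofOpens_carrier {M : Type} [TopologicalSpace M] [T2Space M] [ChartedSpace ℂ M]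
    [IsManifold 𝓘(ℂ, ℂ) ω M] (U : Opens M) (hU : IsConnected (U : Set M)) :
    (ofOpens U hU).carrier = ↥U :=
  rfl

/-! ### §2 The once-punctured elliptic curve -/

section Torus

variable (Φ : (Fin 2 → ℝ) ≃L[ℝ] ℂ) (x₀ : ComplexTorus Φ)

/-- The complement of a point of the complex torus `E = ℂ/Φ(ℤ²)` is connected (it is the
punctured real `2`-torus). [cite: MochizukiAbsTopIII2015, Definition 4.1 (i) p.101] -/
theorem isConnected_compl_singleton_complexTorus : IsConnected ({x₀}ᶜ : Set (ComplexTorus Φ)) :=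
  (PuncturedTorus.isPathConnected_compl_singleton_torus (ι := Fin 2) (i₀ := 0) (i₁ := 1)
    (fun i => by fin_cases i <;> simp) x₀).isConnected

/-- **The once-punctured elliptic curve `E ∖ {x₀}`** (`E = ℂ/Φ(ℤ²)` the complex torus of the tree) as
an object of `HolRS` — the basic hyperbolic Riemann surface of type `(1,1)`, the carrier of the
elliptic cuspidalizations of [AbsTopIII] Cor 2.7. [cite: MochizukiAbsTopIII2015, Definition 4.1 (i) p.101] -/
def puncturedTorus : HolRS :=
  ofOpens (M := ComplexTorus Φ) ⟨{x₀}ᶜ, isOpen_compl_singleton⟩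
    (isConnected_compl_singleton_complexTorus Φ x₀)

/-- The underlying space of `puncturedTorus Φ x₀`. [cite: MochizukiAbsTopIII2015, Definition 4.1 (i) p.101] -/
@[simp] theorem puncturedTorus_carrier :
    (puncturedTorus Φ x₀).carrier = ↥((⟨{x₀}ᶜ, isOpen_compl_singleton⟩ : Opens (ComplexTorus Φ))) :=
  rfl

/-- The punctured elliptic curve is path connected (as the punctured real torus).
[cite: MochizukiAbsTopIII2015, Definition 4.1 (i) p.101] -/
theorem pathConnectedSpace_puncturedTorus : PathConnectedSpace (puncturedTorus Φ x₀).carrier :=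
  PuncturedTorus.pathConnectedSpace_compl_singleton_torus (ι := Fin 2) (i₀ := 0) (i₁ := 1)
    (fun i => by fin_cases i <;> simp) x₀

/-- The punctured elliptic curve is strongly locally contractible.
[cite: MochizukiAbsTopIII2015, Definition 4.1 (i) p.101] -/
theorem stronglyLocallyContractibleSpace_puncturedTorus :
    StronglyLocallyContractibleSpace (puncturedTorus Φ x₀).carrier :=
  stronglyLocallyContractibleSpace_compl_singleton_pi_addCircle (ι := Fin 2) (one_ne_zero (α := ℝ)) x₀

/-- **`π₁` of the once-punctured elliptic curve is free of rank two** (abc-iut-w5-d016's theorem for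
the punctured real torus, read on the complex torus). [cite: MochizukiAbsTopIII2015, Definition 4.1 (i) p.101] -/
theorem nonempty_mulEquiv_freeGroup_puncturedTorus (y : (puncturedTorus Φ x₀).carrier) :
    Nonempty (FundamentalGroup (puncturedTorus Φ x₀).carrier y ≃* FreeGroup (Fin 2)) :=
  PuncturedTorus.nonempty_mulEquiv_freeGroup_puncturedTorus (ι := Fin 2) (i₀ := 0) (i₁ := 1)
    Fin.zero_ne_one (fun i => by fin_cases i <;> simp) x₀ y

/-- **The slice of `HolRS` over a once-punctured elliptic curve is id-rigid, unconditionally**: every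
automorphism of the identity functor of the category of connected Riemann surfaces holomorphic finite
étale over `E ∖ {x₀}` (morphisms over `E ∖ {x₀}`) is trivial — type `(1,1)` of the geometric column of
Prop 4.2 (i). [cite: MochizukiAbsTopIII2015, Proposition 4.2 (i) p.106] -/
theorem isIdRigid_over_puncturedTorus : IsIdRigid (Over (puncturedTorus Φ x₀)) := by
  obtain ⟨y⟩ : Nonempty (puncturedTorus Φ x₀).carrier :=
    (puncturedTorus Φ x₀).connectedSpace.toNonempty
  obtain ⟨e⟩ := nonempty_mulEquiv_freeGroup_puncturedTorus Φ x₀ y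
  haveI := pathConnectedSpace_puncturedTorus Φ x₀
  haveI := stronglyLocallyContractibleSpace_puncturedTorus Φ x₀
  exact (puncturedTorus Φ x₀).isIdRigid_over_of_isIdRigid_connectedCover
    (CovFin.isIdRigid_connected_of_isSlimGroup y
      (Literature.GroupTheory.isSlimGroup_profiniteCompletion_of_mulEquiv_freeGroup e le_rfl))

/-- «Objects of `EA^hol_RS(Q)` mapping to `E ∖ {x₀}`» is id-rigid modulo (H1), for `Q` closed under
finite étale covers and containing the once-punctured elliptic curve — the formal specialisation of
`isIdRigid_mapsTo_of_connectedCover`.  NOTE: at this object the hypothesis `h1` is NOT satisfiable (the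
involution `x ↦ 2x₀ - x` is a non-trivial automorphism commuting with every endomorphism, `Aut(E, x₀)`
being abelian and every finite étale endomorphism of a hyperbolic curve of finite type being an
automorphism), so this statement is VACUOUS here; it is kept only as the recorded shape of the
sufficient criterion.  The EA-level claim at `E ∖ {x₀}` needs print's Lemma 4.3 route
(abc-iut-L4-t14's `LocCategoryGroupModel`). [cite: MochizukiAbsTopIII2015, Proposition 4.2 (i) p.106] -/
theorem isIdRigid_mapsTo_puncturedTorus_of (Q : ObjectProperty HolRS) (hQ : IsCoverClosed Q)
    (hXQ : Q (puncturedTorus Φ x₀))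
    (h1 : ∀ a : puncturedTorus Φ x₀ ≅ puncturedTorus Φ x₀,
      (∀ u : puncturedTorus Φ x₀ ⟶ puncturedTorus Φ x₀, a.hom ≫ u = u ≫ a.hom) → a.hom = 𝟙 _) :
    IsIdRigid (ObjectProperty.FullSubcategory fun Y : Q.FullSubcategory =>
      Nonempty (Y ⟶ ⟨puncturedTorus Φ x₀, hXQ⟩)) := by
  obtain ⟨y⟩ : Nonempty (puncturedTorus Φ x₀).carrier :=
    (puncturedTorus Φ x₀).connectedSpace.toNonempty
  obtain ⟨e⟩ := nonempty_mulEquiv_freeGroup_puncturedTorus Φ x₀ y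
  haveI := pathConnectedSpace_puncturedTorus Φ x₀
  haveI := stronglyLocallyContractibleSpace_puncturedTorus Φ x₀
  exact isIdRigid_mapsTo_of_connectedCover Q hQ ⟨puncturedTorus Φ x₀, hXQ⟩ h1
    (CovFin.isIdRigid_connected_of_isSlimGroup y
      (Literature.GroupTheory.isSlimGroup_profiniteCompletion_of_mulEquiv_freeGroup e le_rfl))

end Torus

end HolRS

end Literature.AnabelianGeometry.AbsoluteAnabelian
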